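import Mathlib
import Summits.Ventures.HodgeRepro.Statements

/-!
# Proof of the sealed statement (b) `MuTable` (blind cell `pub-hodge-repro`, seat p2)

`MuTable` (Statements.lean §B, sha256 1d036903…) is the closed-form / gauge / fixed-point / partition bookkeeping of the
sharpening `μ ↦ μ♯♯` of slot tables: slot `0` is never touched, slots `1, 2, 3` are re-set to `μ S 0 + δ_S`,
`μ S 0 + δ₂`, `μ S 0 + δ₃`, and `δ₂, δ₃` are the two complementary `if`-restrictions of `δ_S`.  Everything follows by
evaluating `Function.update` at the four slots and splitting the `if`s; the hypotheses on `δ` and the seesaw isometry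
are not needed for these identities.
-/

set_option autoImplicit false

namespace Summit.Ventures.HodgeRepro

open MuTable

/-- Slot `0` is untouched by the sharpening. -/
theorem muSharp₂₃_zero {L : Type} [Field L] [NumberField L] [NumberField.IsCMField L] (δ : L)
    (μ : Table L) (S : SeesawDatum L) : muSharp₂₃ δ μ S 0 = μ S 0 := by
  simp [muSharp₂₃, muSharp, Function.update_of_ne]

/-- Slot `1` of the sharpening. -/
theorem muSharp₂₃_one {L : Type} [Field L] [NumberField L] [NumberField.IsCMField L] (δ : L)
    (μ : Table L) (S : SeesawDatum L) : muSharp₂₃ δ μ S 1 = μ S 0 + slotDelta δ S := by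
  simp [muSharp₂₃, muSharp, Function.update_of_ne]

/-- Slot `2` of the sharpening. -/
theorem muSharp₂₃_two {L : Type} [Field L] [NumberField L] [NumberField.IsCMField L] (δ : L)
    (μ : Table L) (S : SeesawDatum L) : muSharp₂₃ δ μ S 2 = μ S 0 + slotDelta₂ δ S := by
  simp [muSharp₂₃, muSharp, Function.update_of_ne]

/-- Slot `3` of the sharpening. -/
theorem muSharp₂₃_three {L : Type} [Field L] [NumberField L] [NumberField.IsCMField L] (δ : L)
    (μ : Table L) (S : SeesawDatum L) : muSharp₂₃ δ μ S 3 = μ S 0 + slotDelta₃ δ S := by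
  simp [muSharp₂₃, muSharp]

/-- The partition `δ₂ + δ₃ = δ_S`, `δ₂ · δ₃ = 0`. -/
theorem slotDelta₂_add_slotDelta₃ {L : Type} [Field L] [NumberField L] [NumberField.IsCMField L] (δ : L)
    (S : SeesawDatum L) (w : NumberField.InfinitePlace L) :
    slotDelta₂ δ S w + slotDelta₃ δ S w = slotDelta δ S w ∧ slotDelta₂ δ S w * slotDelta₃ δ S w = 0 := by
  unfold slotDelta₂ slotDelta₃
  split_ifs <;> simp

/-- The zero table is zero in every slot. -/
theorem muSlotZero_apply {L : Type} [Field L] [NumberField L] [NumberField.IsCMField L] (S : SeesawDatum L)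
    (k : Fin 4) : (muSlotZero : Table L) S k = 0 := rfl

/-- **(b) `MuTable` holds.** -/
theorem muTable_holds : MuTable := by
  intro L _ _ _ δ _ _ S
  refine ⟨?_, ?_, ?_, ?_⟩
  · intro k
    fin_cases k
    · simp [muSharp₂₃_zero, muSlotZero_apply]
    · simp [muSharp₂₃_one, muSlotZero_apply]
    · simp [muSharp₂₃_two, muSlotZero_apply]
    · simp [muSharp₂₃_three, muSlotZero_apply]
  · intro μ k
    fin_cases k
    · simp [muSharp₂₃_zero, muSlotZero_apply]
    · simp [muSharp₂₃_one, muSlotZero_apply]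
    · simp [muSharp₂₃_two, muSlotZero_apply]
    · simp [muSharp₂₃_three, muSlotZero_apply]
  · intro μ
    funext k
    fin_cases k
    · simp [muSharp₂₃_zero]
    · simp [muSharp₂₃_one, muSharp₂₃_zero]
    · simp [muSharp₂₃_two, muSharp₂₃_zero]
    · simp [muSharp₂₃_three, muSharp₂₃_zero]
  · intro w
    exact slotDelta₂_add_slotDelta₃ δ S w

end Summit.Ventures.HodgeRepro
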